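import Summits.QuantumFields.YangMills.Theorems.RevelationMartingaleMeanDeviationLogDepthLetters
import HarnessLib

/-!
# Line «revelation_martingale» on crux `HistoryTailL` (stmt-QuantumFields-19936) — its centring stub `stub_meanDeviationShallow`
# (`MeanDeviationShallowL`, stmt-QuantumFields-23133) AT LOGARITHMIC DEPTH, VOLUME-UNIFORMLY, WITH `γ₁` INDEPENDENT OF THE DEPTH

Cell `ym3-torus` (YM ladder rung R3 = continuum SU(2) Yang–Mills on the three-torus — a RUNG, NOT the Clay problem: not d = 4, not infinite
volume, not a mass gap), width seat `ym-ust-19936-w3` gen 9.  The registered line «revelation_martingale» v3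
(`Cruxes/HistoryTailL/Lines/revelation_martingale.lean`) carries the centring stub `stub_meanDeviationShallow : MeanDeviationShallowL`: for every `L`
a depth fraction `N₁` such that `∫ dist1(Ū^j(∂p)) d(gibbsK K) ≤ ½θ(b₀)(K−j)` for all `1 ≤ j`, `N₁·j ≤ K`, uniformly in `K`.  Gen 8 of this seat
(✓ `RevelationMartingaleMeanDeviationBoundedDepth.meanDeviation_boundedDepth`) proved the bound at BOUNDED depth `j ≤ j₀` with `γ₁ = γ₁(j₀)`, from the
crude local Prop. 1 iterated (constants `(81L³)^{j₀}`, `(151L²)^{−2j₀}`).  THIS FILE proves it at LOGARITHMIC depth with ONE `γ₁ = γ₁(L, b₀, p₀)`: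

  ★ `meanDeviation_logDepth` — for every `L`, `b₀ > 0`, `p₀ > 2` there is `γ₁ ∈ (0, 1]` such that for every family `F` (`F.L = L`), every
  `0 < γ ≤ γ₁`, every `1 ≤ j ≤ K` satisfying the DEPTH HYPOTHESIS `b₀·L^{3j} ≤ p(g_{K−j})` (i.e. `L^{3j} ≤ (1 + log g_{K−j}⁻¹)^{p₀}`,
  `j ≲ (p₀/3)·log_L log β_{K−j}`) and every plaquette `p` of `T^{(j)}`: `∫ dist1(Ū^j(∂p)) d(gibbsK K) ≤ ½·θ(b₀)(K−j)`.

Mechanism (all by name): the `k`-UNIFORM LOCAL Proposition 2 of [Balaban1985Averaging] for the averaging of record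
(✓ `N21LocalAveragedRegularity.plaqSmallOn_iter_blockAvg_eml_loc_pow`: fine plaquettes `α₀L^{−2j}`-small on the fine box of radius `L^j((d+4)L+2)` below
the corner of `p` ⇒ `|Ū^j(∂p) − 1| < α₀ + 2C₀α₀²`, NO `(151L²)^j` loss) at `α₀ = (3/20)θ`, the union bound over that box (`card_boxRegion_le`), the
volume-uniform per-plaquette chessboard bound `T3FinestHeightTail.gibbsMeasure_real_dist1_ge_le` (reflection positivity), and gen 8's layer cake
`integral_le_add_mul_measureReal_ge'`.  The Gaussian exponent is `β_K a²/4 = (9/1600)·p(g_{K−j})²·L^{−3j}`, which the depth hypothesis keeps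
`≥ (9/1600)·b₀·p(g_{K−j})`; the prefactors (`#box ≤ 243(7L+2)³L^{3j}`, `(√β_K)^9`) are powers of `(1 + log g⁻¹)` and `g⁻¹`, beaten by
`exp(−c·b₀²(1 + log g⁻¹)²)` once `log g⁻¹ ≥ X₀(L, b₀, p₀)`, i.e. once `γ ≤ e^{−2X₀}`.

Letters (deterministic step, cover, box count, real analysis) are in the sibling ✓ `RevelationMartingaleMeanDeviationLogDepthLetters`.
* ★ `meanDeviation_logDepth` — the statement above.
(The bounded-depth statement — every `j ≤ j₀` satisfies the depth hypothesis once `½ log γ⁻¹ ≥ L^{3j₀}` — is gen 8's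
✓ `RevelationMartingaleMeanDeviationBoundedDepth.meanDeviation_boundedDepth`; not restated here.)

HONEST LOCATED CONTENT (kernel face of the LEAD's TEST 3 for the centring stub).  The range `N₁·j ≤ K` of `MeanDeviationShallowL` is NOT reached:
the depth hypothesis is logarithmic in `K`, and it is where BOTH elementary routes stop — this one (exponent `p²·L^{−3j}`) and a chessboard estimate
at level `j` itself (Haar entropy `≈ L^{3j}·log β_K` per cell against an exponent `≈ p²/(j log L)`).  Beyond, a `K`-uniform first-moment bound for
block-averaged plaquettes is Gaussian domination of the `j`-fold average under `gibbsK` (the renormalisation-group content).  Nothing of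
`MeanDeviationShallowL`/`MeanDeviationL`, `SubGaussianRevelationL`, the crux `HistoryTailL`, the rung R3, d = 4, a continuum limit or a mass gap is
proved here.  YM₃ on T³ is rung R3, NOT the Clay problem.

References: T. Bałaban, CMP **98** (1985) 17–51 [Balaban1985Averaging] (Prop. 2 (52)–(54) p.26); CMP **102** (1985) 255–275 [Balaban1985UV3]
((7) p.257, (71) p.273); J. Fröhlich, R. Israel, E. Lieb, B. Simon, CMP 62 (1978) [FrohlichIsraelLiebSimon1978] (Thm 4.1, chessboard).
-/
noncomputable section

open MeasureTheory
open scoped BigOperators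
open Literature.MathematicalPhysics.QuantumFieldTheory.Balaban1983to89
open Literature.MathematicalPhysics.QuantumFieldTheory.Balaban1983to89.T3ContinuumYM3Torus
open Literature.MathematicalPhysics.QuantumFieldTheory.Balaban1983to89.T3UnitScaleTilt
open Literature.MathematicalPhysics.QuantumFieldTheory.Balaban1983to89.T3UnitLawDensityEML (ℰp)
open Literature.MathematicalPhysics.QuantumFieldTheory.Balaban1983to89.T3FinestHeightTail
  (gibbsMeasure_real_dist1_ge_le beta_mul_θBal_sq)
open Literature.MathematicalPhysics.QuantumFieldTheory.Balaban1983to89.T3Thresholds (exists_gamma_forall_θBal_le coupling_le_one)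
open Literature.MathematicalPhysics.QuantumFieldTheory.Balaban1983to89.T3ThresholdSmallness (sqrt_coupling_pos_le)
open Literature.MathematicalPhysics.QuantumFieldTheory.Balaban1983to89.T3UpperLiftSplit (scheme_β_eq)
open Literature.MathematicalPhysics.QuantumFieldTheory.Balaban1983to89.ExpMeanLog (deltaSU expMeanLogSU)
open Literature.MathematicalPhysics.QuantumFieldTheory.Balaban1983to89.BlockAveraging (blockAvg)
open Literature.MathematicalPhysics.QuantumFieldTheory.Balaban1983to89.T4PairDerivBridge (dist1_le_two_specialUnitaryGroup)
open Summit.QuantumFields.YangMills.BalabanUVNodes.N20LCSAvgDominationRegion (boxRegion mem_boxRegion card_boxRegion_le)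
open Summit.QuantumFields.YangMills.Theorems.N21LocalAveragedRegularity (exists_embChain plaqSmallOn_iter_blockAvg_eml_loc_pow)
open Summit.QuantumFields.YangMills.Theorems.HistoryTailBoundedHeight (scheme_β_add one_le_scheme_β θBal_nonneg' third_le_deltaSU_two)
open Summit.QuantumFields.YangMills.Theorems.HistoryTailBoundedHeightLocal (card_planePairs)
open Summit.QuantumFields.YangMills.Theorems.RevelationMartingaleMeanDeviationBoundedDepth (integral_le_add_mul_measureReal_ge')
open Summit.QuantumFields.YangMills.Theorems.RevelationMartingaleMeanDeviationLogDepthLetters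
namespace Summit.QuantumFields.YangMills.Theorems.RevelationMartingaleMeanDeviationLogDepth

/-! ## `MeanDeviationL` at logarithmic depth -/

section Main

/-- **`MeanDeviationL` AT LOGARITHMIC DEPTH, VOLUME-UNIFORMLY, `γ₁` INDEPENDENT OF THE DEPTH.**  For every `L` and profile `b₀ > 0`, `p₀ > 2` there is
`γ₁ ∈ (0, 1]` such that for every family `F` with `F.L = L`, every `0 < γ ≤ γ₁`, every `1 ≤ j ≤ K` with `b₀·L^{3j} ≤ p(g_{K−j})`
(`p(g) = b₀(1 + log g⁻¹)^{p₀}`, `g_{K−j} = √(γL^{−(K−j)})`) and every plaquette `p` of `T^{(j)}`: `∫ dist1(Ū^j(∂p)) d(gibbsK K) ≤ ½·θ(b₀)(K−j)`.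
Layer cake at `θ/4` + §2 at `α₀ = (3/20)θ` (Prop. 2's window from `T3Thresholds.exists_gamma_forall_θBal_le`) + the per-plaquette chessboard bound +
the exponent `β_K a²/4 = (9/1600)p²L^{−3j} ≥ (9/1600)b₀p`. [cite: Balaban1985UV3, (7) p.257 and (71) p.273; Balaban1985Averaging, Prop. 2 (52)–(54) p.26] -/
theorem meanDeviation_logDepth (L : ℕ) {b₀ p₀ : ℝ} (hb₀ : 0 < b₀) (hp₀ : 2 < p₀) :
    ∃ γ₁ : ℝ, 0 < γ₁ ∧ γ₁ ≤ 1 ∧ ∀ (F : T3Family) (γ : ℝ), F.L = L → 0 < γ → γ ≤ γ₁ → ∀ (K j : ℕ), 1 ≤ j → j ≤ K →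
      b₀ * (F.L : ℝ) ^ (3 * j) ≤ B10.pFun b₀ p₀ (Real.sqrt (γ * ((F.L : ℝ)⁻¹) ^ (K - j))) →
      ∀ p : Plaq (F.P K) j,
        ∫ U, GaugeGroup.dist1 (GaugeField.plaqHol (Averaging.iter (fun i => BlockAveraging.blockAvg (P := F.P K) (j := i) ℰp) j U) p)
            ∂(gibbsK F ℰp γ K) ≤ θBal F.L γ b₀ p₀ (K - j) / 2 := by
  obtain ⟨c₀, hc₀, _, hch⟩ := gibbsMeasure_real_dist1_ge_le (N := 2)
  -- degenerate block size: no family has `F.L = L ≤ 1`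
  by_cases hL : 1 < L
  swap
  · exact ⟨1, one_pos, le_rfl, fun F γ hFL => absurd (hFL ▸ F.hL.2) hL⟩
  have hLr : (1 : ℝ) < L := by exact_mod_cast hL
  have hLr0 : (0 : ℝ) < L := one_pos.trans hLr
  -- Prop 2's constant and window
  set C₀ : ℝ := 143 * ((((3 + 4 : ℕ) : ℝ)) ^ 2 / 4) ^ 2 with hC₀
  have hC₀pos : 0 < C₀ := by positivity
  set σ : ℝ := min (20 / (9 * C₀)) (20 / (441 * (L : ℝ) ^ 2)) with hσ
  have hσpos : 0 < σ := lt_min (by positivity) (by positivity)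
  obtain ⟨γa, hγa, hγa1, hθσ⟩ := exists_gamma_forall_θBal_le (b₀ := b₀) (p₀ := p₀) hb₀ (by linarith) hσpos
  -- the analytic threshold
  set C₁ : ℝ := 2 * Real.exp 24 * (c₀ ^ 3)⁻¹ with hC₁
  have hC₁0 : 0 < C₁ := by positivity
  have hApos : 0 < 243 * (7 * (L : ℝ) + 2) ^ 3 * C₁ := by positivity
  obtain ⟨X₀, hX₀, hthr⟩ := exists_threshold_exp_le (q := 6 * p₀ + 11) hApos hb₀ (by norm_num : (0 : ℝ) < 9 / 1600) (by linarith)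
  set γb : ℝ := Real.exp (-(2 * X₀)) with hγb
  have hγb0 : 0 < γb := Real.exp_pos _
  refine ⟨min γa γb, lt_min hγa hγb0, (min_le_left _ _).trans hγa1, ?_⟩
  intro F γ hFL hγ hγ1 K j hj1 hjK hdepth p
  subst hFL
  have hγa' : γ ≤ γa := hγ1.trans (min_le_left _ _)
  have hγb' : γ ≤ γb := hγ1.trans (min_le_right _ _)
  have hγone : γ ≤ 1 := hγa'.trans hγa1
  have hL1 : 1 ≤ F.L := F.hL.2.le
  have hL1r : (1 : ℝ) ≤ F.L := by exact_mod_cast hL1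
  haveI := isProbabilityMeasure_gibbsK F ℰp hγ.le K
  -- names
  set i : ℕ := K - j with hi
  have hK : K = i + j := by omega
  set g : ℝ := Real.sqrt (γ * ((F.L : ℝ)⁻¹) ^ i) with hg
  have hg0 : 0 < g := (sqrt_coupling_pos_le hL1 hγ i).1
  have hgγ : g ≤ Real.sqrt γ := (sqrt_coupling_pos_le hL1 hγ i).2
  have hg1 : g ≤ 1 := coupling_le_one hL1 hγ hγone i
  set u : ℝ := Real.log g⁻¹ with hu
  have hu0 : 0 ≤ u := B10.log_inv_nonneg_of_le_one hg0 hg1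
  have h1u : 1 ≤ 1 + u := by linarith
  set P : ℝ := B10.pFun b₀ p₀ g with hP
  set y : ℝ := (1 + u) ^ p₀ with hy
  have hPy : P = b₀ * y := rfl
  have hy1 : 1 ≤ y := Real.one_le_rpow h1u (by linarith)
  have hy0 : 0 < y := one_pos.trans_le hy1
  have hP0 : 0 < P := by rw [hPy]; positivity
  set θ : ℝ := θBal F.L γ b₀ p₀ i with hθ
  have hθgP : θ = g * P := rfl
  have hθ0 : 0 < θ := by rw [hθgP]; positivity
  -- `g = e^{-u}`, `u ≥ X₀`
  have hgexp : g = Real.exp (-u) := by rw [hu, Real.log_inv, neg_neg, Real.exp_log hg0]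
  have huX : X₀ ≤ u := by
    have h1 : Real.log g ≤ Real.log (Real.sqrt γ) := Real.log_le_log hg0 hgγ
    have h2 : Real.log (Real.sqrt γ) = Real.log γ / 2 := Real.log_sqrt hγ.le
    have h3 : Real.log γ ≤ -(2 * X₀) := by
      have := Real.log_le_log hγ hγb'
      rwa [hγb, Real.log_exp] at this
    have h4 : u = -Real.log g := by rw [hu, Real.log_inv]
    linarith
  -- the couplings `β_i = g⁻² = e^{2u}`, `β_K = L^j β_i ≥ 1`
  set βi : ℝ := (F.scheme ℰp γ).β i with hβi
  set βK : ℝ := (F.scheme ℰp γ).β K with hβK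
  have hβieq : βi = (g ^ 2)⁻¹ := by
    rw [hβi, scheme_β_eq, hg, Real.sq_sqrt (le_of_lt (mul_pos hγ (pow_pos (inv_pos.mpr (by positivity)) _)))]
  have hβiexp : βi = Real.exp (2 * u) := by
    rw [hβieq, hgexp, ← Real.exp_nat_mul, ← Real.exp_neg]; congr 1; push_cast; ring
  have hβKeq : βK = (F.L : ℝ) ^ j * βi := by rw [hβK, hK, scheme_β_add]
  have hβK1 : 1 ≤ βK := one_le_scheme_β F hγ hγone K
  have hβθ : βi * θ ^ 2 = P ^ 2 := beta_mul_θBal_sq F hγ b₀ p₀ i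
  -- the depth hypothesis: `L^{3j} ≤ y`, hence `L^j ≤ y`
  have hLj1 : (1 : ℝ) ≤ (F.L : ℝ) ^ j := one_le_pow₀ hL1r
  have hLj0 : (0 : ℝ) < (F.L : ℝ) ^ j := by positivity
  have hL3y : ((F.L : ℝ) ^ j) ^ 3 ≤ y := by
    have h1 : b₀ * ((F.L : ℝ) ^ j) ^ 3 ≤ b₀ * y := by
      rw [← pow_mul, mul_comm j 3, ← hPy]; exact hdepth
    exact le_of_mul_le_mul_left h1 hb₀
  have hLjy : (F.L : ℝ) ^ j ≤ y := by
    calc (F.L : ℝ) ^ j = ((F.L : ℝ) ^ j) ^ 1 := (pow_one _).symm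
      _ ≤ ((F.L : ℝ) ^ j) ^ 3 := pow_le_pow_right₀ hLj1 (by norm_num)
      _ ≤ y := hL3y
  -- `y ≤ e^{p₀ u}`, `(1+u)² ≤ y`, `β_K ≤ y e^{2u}`
  have hyexp : y ≤ Real.exp (p₀ * u) := by
    rw [hy, mul_comm, Real.exp_mul]
    exact Real.rpow_le_rpow (by linarith) (by linarith [Real.add_one_le_exp u]) (by linarith)
  have hysq : (1 + u) ^ 2 ≤ y := by
    rw [hy, ← Real.rpow_two]
    exact Real.rpow_le_rpow_of_exponent_le h1u hp₀.le
  have hβKle : βK ≤ y * Real.exp (2 * u) := by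
    rw [hβKeq, hβiexp]
    exact mul_le_mul_of_nonneg_right hLjy (Real.exp_pos _).le
  -- Prop 2's window at `α₀ = (3/20)θ`
  have hθσ' : θ ≤ σ := hθσ F.L hL1 γ hγ hγa' i
  set α₀ : ℝ := 3 / 20 * θ with hα₀
  have hα : 0 < α₀ := by positivity
  have hd : (F.P K).d = 3 := rfl
  have hPL : (F.P K).L = F.L := rfl
  have hα3 : (143 * (((((F.P K).d + 4 : ℕ) : ℝ)) ^ 2 / 4) ^ 2) * α₀ ≤ 1 / 3 := by
    rw [hd]
    have h1 : θ ≤ 20 / (9 * C₀) := hθσ'.trans (min_le_left _ _)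
    have h2 : C₀ * θ ≤ 20 / 9 := by
      calc C₀ * θ ≤ C₀ * (20 / (9 * C₀)) := mul_le_mul_of_nonneg_left h1 hC₀pos.le
        _ = 20 / 9 := by field_simp
    show C₀ * (3 / 20 * θ) ≤ 1 / 3
    linarith
  have hα2 : 2 * α₀ ≤ 2 * deltaSU (Fin 2) / ((((F.P K).d + 4) * (F.P K).L : ℕ) : ℝ) ^ 2 := by
    rw [hd, hPL]
    have h1 : θ ≤ 20 / (441 * (F.L : ℝ) ^ 2) := hθσ'.trans (min_le_right _ _)
    have hL2 : (0 : ℝ) < (F.L : ℝ) ^ 2 := by positivity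
    have hcast : ((((3 + 4) * F.L : ℕ) : ℝ)) ^ 2 = 49 * (F.L : ℝ) ^ 2 := by push_cast; ring
    rw [hcast]
    have hδ := third_le_deltaSU_two
    have h2 : 2 * (1 / 3 : ℝ) / (49 * (F.L : ℝ) ^ 2) ≤ 2 * deltaSU (Fin 2) / (49 * (F.L : ℝ) ^ 2) := by
      gcongr
    refine le_trans ?_ h2
    rw [hα₀, le_div_iff₀ (by positivity)]
    have h3 : θ * (441 * (F.L : ℝ) ^ 2) ≤ 20 := (le_div_iff₀ (by positivity)).mp h1
    linarith
  have hquarter : α₀ + 2 * (143 * (((((F.P K).d + 4 : ℕ) : ℝ)) ^ 2 / 4) ^ 2) * α₀ ^ 2 ≤ θ / 4 := by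
    have h1 : (143 * (((((F.P K).d + 4 : ℕ) : ℝ)) ^ 2 / 4) ^ 2) * α₀ ^ 2 ≤ 1 / 3 * α₀ := by
      calc (143 * (((((F.P K).d + 4 : ℕ) : ℝ)) ^ 2 / 4) ^ 2) * α₀ ^ 2
          = ((143 * (((((F.P K).d + 4 : ℕ) : ℝ)) ^ 2 / 4) ^ 2) * α₀) * α₀ := by ring
        _ ≤ 1 / 3 * α₀ := mul_le_mul_of_nonneg_right hα3 hα.le
    have : α₀ + 2 * (143 * (((((F.P K).d + 4 : ℕ) : ℝ)) ^ 2 / 4) ^ 2) * α₀ ^ 2 ≤ α₀ + 2 * (1 / 3 * α₀) := by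
      rw [mul_assoc]; linarith
    refine this.trans (le_of_eq ?_)
    rw [hα₀]; ring
  -- layer cake at `a = θ/4`
  have hf0 : ∀ U : GaugeField (F.P K) 0 (Matrix.specialUnitaryGroup (Fin 2) ℂ), 0 ≤ GaugeGroup.dist1 (GaugeField.plaqHol
      (Averaging.iter (fun i => BlockAveraging.blockAvg (P := F.P K) (j := i) ℰp) j U) p) := fun U => GaugeGroup.dist1_nonneg _
  have hf2 : ∀ U : GaugeField (F.P K) 0 (Matrix.specialUnitaryGroup (Fin 2) ℂ), GaugeGroup.dist1 (GaugeField.plaqHol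
      (Averaging.iter (fun i => BlockAveraging.blockAvg (P := F.P K) (j := i) ℰp) j U) p) ≤ 2 :=
    fun U => dist1_le_two_specialUnitaryGroup _
  have hlayer := integral_le_add_mul_measureReal_ge' (μ := gibbsK F ℰp γ K) (a := θ / 4) (by positivity) zero_le_two hf0 hf2
  -- the chain of block centres below `p₋` and the cover of §2
  obtain ⟨xs, hxj, hxs⟩ := exists_embChain (P := F.P K) j p.src
  have hcover := gibbsK_real_le_sum_box F hγ.le hα hα3 hα2 hquarter p xs hxj hxs
  set B := boxRegion (xs 0) ((F.P K).L ^ j * (0 + (((F.P K).d + 4) * (F.P K).L + 2))) with hB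
  set a : ℝ := α₀ * ((((F.P K).L : ℝ) ^ j)⁻¹) ^ 2 with ha
  have ha0 : 0 ≤ a := by positivity
  -- the per-fine-plaquette chessboard bound (volume-uniform)
  have hterm : ∀ q : Plaq (F.P K) 0,
      (gibbsK F ℰp γ K).real {U | a ≤ GaugeGroup.dist1 (GaugeField.plaqHol U q)} ≤
        C₁ * Real.sqrt βK ^ 9 * Real.exp (-(βK * a ^ 2 / 4)) := by
    intro q
    have hq := hch (F.P K) βK hβK1 a ha0 q
    rw [gibbsK_eq]
    refine hq.trans (le_of_eq ?_)
    rw [card_planePairs F K, hd, hC₁]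
    have hexp : βK * a ^ 2 / (2 * (2 : ℕ)) = βK * a ^ 2 / 4 := by norm_num
    rw [hexp]
    norm_num
  have hsum : ∑ q ∈ B, (gibbsK F ℰp γ K).real {U | a ≤ GaugeGroup.dist1 (GaugeField.plaqHol U q)} ≤
      B.card * (C₁ * Real.sqrt βK ^ 9 * Real.exp (-(βK * a ^ 2 / 4))) := by
    have h := Finset.sum_le_sum fun q (_ : q ∈ B) => hterm q
    rwa [Finset.sum_const, nsmul_eq_mul] at h
  -- the Gaussian factor and the assembly (§3)
  have hE : Real.exp (-(βK * a ^ 2 / 4)) ≤ Real.exp (-(9 / 1600 * b₀ ^ 2 * y)) := by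
    have h := exp_gauss_le (βi := βi) (θ := θ) hLj0 hb₀ hy0 hβθ hPy hL3y
    rw [ha, hPL, hα₀, hβKeq]
    exact h
  have hmain : 2 * ((B.card : ℝ) * (C₁ * Real.sqrt βK ^ 9 * Real.exp (-(βK * a ^ 2 / 4)))) ≤ θ / 4 := by
    have h := two_mul_card_mul_term_le (n := (B.card : ℝ)) hC₁0.le hb₀ (by positivity) (hthr u huX) hy1 hysq hyexp
      hβK1 hβKle (card_box_le F (xs 0) j |>.trans (mul_le_mul_of_nonneg_left hL3y (by positivity))) (Real.exp_pos _).le hE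
    rw [hθgP, hPy, hgexp]
    exact h
  -- conclude
  have hevent : (gibbsK F ℰp γ K).real {U | θ / 4 ≤ GaugeGroup.dist1 (GaugeField.plaqHol
      (Averaging.iter (fun i => BlockAveraging.blockAvg (P := F.P K) (j := i) ℰp) j U) p)} ≤
      (B.card : ℝ) * (C₁ * Real.sqrt βK ^ 9 * Real.exp (-(βK * a ^ 2 / 4))) :=
    hcover.trans hsum
  calc ∫ U, GaugeGroup.dist1 (GaugeField.plaqHol
          (Averaging.iter (fun i => BlockAveraging.blockAvg (P := F.P K) (j := i) ℰp) j U) p) ∂(gibbsK F ℰp γ K)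
      ≤ θ / 4 + 2 * (gibbsK F ℰp γ K).real {U | θ / 4 ≤ GaugeGroup.dist1 (GaugeField.plaqHol
          (Averaging.iter (fun i => BlockAveraging.blockAvg (P := F.P K) (j := i) ℰp) j U) p)} := hlayer
    _ ≤ θ / 4 + θ / 4 := add_le_add le_rfl ((mul_le_mul_of_nonneg_left hevent zero_le_two).trans hmain)
    _ = θ / 2 := by ring

end Main

/-! ## The per-plaquette averaged tail at every depth, volume-uniformly, with the depth explicit in the exponent -/

section Tail

/-- **THE PER-PLAQUETTE LARGE-FIELD TAIL OF THE BLOCK-AVERAGED FIELD AT EVERY DEPTH, VOLUME-UNIFORMLY, DEPTH EXPLICIT** (LEAD ask (a); the step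
before the layer cake).  For every `L`, `b₀ > 0`, `p₀ > 0` there are `γ₁ ∈ (0, 1]` (Prop. 2's window only) and `C ≥ 0` (depending on `L` only:
`C = 243(7L+2)³·2e^{24}c₀^{−3}`) such that for every family `F` (`F.L = L`), every `0 < γ ≤ γ₁`, every `j ≤ K` and every plaquette `p` of `T^{(j)}`:
`Gibbs_K{θ(K−j) ≤ |Ū^j(∂p) − 1|} ≤ C·(L^j)^8·β_{K−j}^5·exp(−(9/1600)·p(g_{K−j})²/L^{3j})` — NO volume factor (the box below `p₋` only) and the
`k`-UNIFORM exponent `p²·L^{−3j}` (the tree's ✓ `…TailElementaryEnvelope` has `L^{3m}` and `p²·L^{j}/(151L²)^{2j}`).  On the log-depth envelope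
`b₀L^{3j} ≤ p(g_{K−j})` the right side is `≤ C·(p/b₀)^{8/3}·β_{K−j}^5·e^{−(9/1600)b₀·p}`; beyond it the bound is void — the located elementary
frontier. [cite: Balaban1985UV3, (7) p.257 and (71) p.273; Balaban1985Averaging, Prop. 2 (52)–(54) p.26] -/
theorem perPlaquette_tail_allDepths (L : ℕ) {b₀ p₀ : ℝ} (hb₀ : 0 < b₀) (hp₀ : 0 < p₀) :
    ∃ (γ₁ C : ℝ), 0 < γ₁ ∧ γ₁ ≤ 1 ∧ 0 ≤ C ∧ ∀ (F : T3Family) (γ : ℝ), F.L = L → 0 < γ → γ ≤ γ₁ → ∀ (K j : ℕ), j ≤ K →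
      ∀ p : Plaq (F.P K) j,
        (gibbsK F ℰp γ K).real {U | θBal F.L γ b₀ p₀ (K - j) ≤
            GaugeGroup.dist1 (GaugeField.plaqHol
              (Averaging.iter (fun i => BlockAveraging.blockAvg (P := F.P K) (j := i) ℰp) j U) p)} ≤
          C * ((F.L : ℝ) ^ j) ^ 8 * (F.scheme ℰp γ).β (K - j) ^ 5 *
            Real.exp (-(9 / 1600 * B10.pFun b₀ p₀ (Real.sqrt (γ * ((F.L : ℝ)⁻¹) ^ (K - j))) ^ 2 / ((F.L : ℝ) ^ j) ^ 3)) := by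
  obtain ⟨c₀, hc₀, _, hch⟩ := gibbsMeasure_real_dist1_ge_le (N := 2)
  -- degenerate block size: no family has `F.L = L ≤ 1`
  by_cases hL : 1 < L
  swap
  · exact ⟨1, 0, one_pos, le_rfl, le_rfl, fun F γ hFL => absurd (hFL ▸ F.hL.2) hL⟩
  have hLr : (1 : ℝ) < L := by exact_mod_cast hL
  have hLr0 : (0 : ℝ) < L := one_pos.trans hLr
  -- Prop 2's constant and window
  set C₀ : ℝ := 143 * ((((3 + 4 : ℕ) : ℝ)) ^ 2 / 4) ^ 2 with hC₀
  have hC₀pos : 0 < C₀ := by positivity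
  set σ : ℝ := min (20 / (9 * C₀)) (20 / (441 * (L : ℝ) ^ 2)) with hσ
  have hσpos : 0 < σ := lt_min (by positivity) (by positivity)
  obtain ⟨γa, hγa, hγa1, hθσ⟩ := exists_gamma_forall_θBal_le (b₀ := b₀) (p₀ := p₀) hb₀ hp₀ hσpos
  set C₁ : ℝ := 2 * Real.exp 24 * (c₀ ^ 3)⁻¹ with hC₁
  have hC₁0 : 0 < C₁ := by positivity
  refine ⟨γa, 243 * (7 * (L : ℝ) + 2) ^ 3 * C₁, hγa, hγa1, by positivity, ?_⟩
  intro F γ hFL hγ hγ1 K j hjK p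
  subst hFL
  have hγone : γ ≤ 1 := hγ1.trans hγa1
  have hL1 : 1 ≤ F.L := F.hL.2.le
  have hL1r : (1 : ℝ) ≤ F.L := by exact_mod_cast hL1
  haveI := isProbabilityMeasure_gibbsK F ℰp hγ.le K
  set i : ℕ := K - j with hi
  have hK : K = i + j := by omega
  set P : ℝ := B10.pFun b₀ p₀ (Real.sqrt (γ * ((F.L : ℝ)⁻¹) ^ i)) with hP
  set θ : ℝ := θBal F.L γ b₀ p₀ i with hθ
  have hθ0 : 0 ≤ θ := θBal_nonneg' F hγ hγone hb₀.le p₀ i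
  set βi : ℝ := (F.scheme ℰp γ).β i with hβi
  set βK : ℝ := (F.scheme ℰp γ).β K with hβK
  have hβKeq : βK = (F.L : ℝ) ^ j * βi := by rw [hβK, hK, scheme_β_add]
  have hβK1 : 1 ≤ βK := one_le_scheme_β F hγ hγone K
  have hβθ : βi * θ ^ 2 = P ^ 2 := beta_mul_θBal_sq F hγ b₀ p₀ i
  have hLj0 : (0 : ℝ) < (F.L : ℝ) ^ j := by positivity
  have hθσ' : θ ≤ σ := hθσ F.L hL1 γ hγ hγ1 i
  set α₀ : ℝ := 3 / 20 * θ with hα₀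
  have hd : (F.P K).d = 3 := rfl
  have hPL : (F.P K).L = F.L := rfl
  have hθpos : 0 < θ := by
    rw [hθ]
    exact Literature.MathematicalPhysics.QuantumFieldTheory.Balaban1983to89.T3MinimiserStabilityReduction.θBal_pos hL1 hγ hγone hb₀ p₀ i
  have hα : 0 < α₀ := by positivity
  have hα3 : (143 * (((((F.P K).d + 4 : ℕ) : ℝ)) ^ 2 / 4) ^ 2) * α₀ ≤ 1 / 3 := by
    rw [hd]
    have h1 : θ ≤ 20 / (9 * C₀) := hθσ'.trans (min_le_left _ _)
    have h2 : C₀ * θ ≤ 20 / 9 := by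
      calc C₀ * θ ≤ C₀ * (20 / (9 * C₀)) := mul_le_mul_of_nonneg_left h1 hC₀pos.le
        _ = 20 / 9 := by field_simp
    show C₀ * (3 / 20 * θ) ≤ 1 / 3
    linarith
  have hα2 : 2 * α₀ ≤ 2 * deltaSU (Fin 2) / ((((F.P K).d + 4) * (F.P K).L : ℕ) : ℝ) ^ 2 := by
    rw [hd, hPL]
    have h1 : θ ≤ 20 / (441 * (F.L : ℝ) ^ 2) := hθσ'.trans (min_le_right _ _)
    have hL2 : (0 : ℝ) < (F.L : ℝ) ^ 2 := by positivity
    have hcast : ((((3 + 4) * F.L : ℕ) : ℝ)) ^ 2 = 49 * (F.L : ℝ) ^ 2 := by push_cast; ring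
    rw [hcast]
    have hδ := third_le_deltaSU_two
    have h2 : 2 * (1 / 3 : ℝ) / (49 * (F.L : ℝ) ^ 2) ≤ 2 * deltaSU (Fin 2) / (49 * (F.L : ℝ) ^ 2) := by gcongr
    refine le_trans ?_ h2
    rw [hα₀, le_div_iff₀ (by positivity)]
    have h3 : θ * (441 * (F.L : ℝ) ^ 2) ≤ 20 := (le_div_iff₀ (by positivity)).mp h1
    linarith
  have hθ' : α₀ + 2 * (143 * (((((F.P K).d + 4 : ℕ) : ℝ)) ^ 2 / 4) ^ 2) * α₀ ^ 2 ≤ θ := by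
    have h1 : (143 * (((((F.P K).d + 4 : ℕ) : ℝ)) ^ 2 / 4) ^ 2) * α₀ ^ 2 ≤ 1 / 3 * α₀ := by
      calc (143 * (((((F.P K).d + 4 : ℕ) : ℝ)) ^ 2 / 4) ^ 2) * α₀ ^ 2
          = ((143 * (((((F.P K).d + 4 : ℕ) : ℝ)) ^ 2 / 4) ^ 2) * α₀) * α₀ := by ring
        _ ≤ 1 / 3 * α₀ := mul_le_mul_of_nonneg_right hα3 hα.le
    have : α₀ + 2 * (143 * (((((F.P K).d + 4 : ℕ) : ℝ)) ^ 2 / 4) ^ 2) * α₀ ^ 2 ≤ α₀ + 2 * (1 / 3 * α₀) := by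
      rw [mul_assoc]; linarith
    refine this.trans ?_
    rw [hα₀]; linarith
  -- the chain of block centres below `p₋` and the cover of the letters file
  obtain ⟨xs, hxj, hxs⟩ := exists_embChain (P := F.P K) j p.src
  have hcover := gibbsK_real_le_sum_box F hγ.le hα hα3 hα2 hθ' p xs hxj hxs
  set B := boxRegion (xs 0) ((F.P K).L ^ j * (0 + (((F.P K).d + 4) * (F.P K).L + 2))) with hB
  set a : ℝ := α₀ * ((((F.P K).L : ℝ) ^ j)⁻¹) ^ 2 with ha
  have ha0 : 0 ≤ a := by positivity
  -- the per-fine-plaquette chessboard bound (volume-uniform)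
  have hterm : ∀ q : Plaq (F.P K) 0,
      (gibbsK F ℰp γ K).real {U | a ≤ GaugeGroup.dist1 (GaugeField.plaqHol U q)} ≤
        C₁ * Real.sqrt βK ^ 9 * Real.exp (-(βK * a ^ 2 / 4)) := by
    intro q
    have hq := hch (F.P K) βK hβK1 a ha0 q
    rw [gibbsK_eq]
    refine hq.trans (le_of_eq ?_)
    rw [card_planePairs F K, hd, hC₁]
    have hexp : βK * a ^ 2 / (2 * (2 : ℕ)) = βK * a ^ 2 / 4 := by norm_num
    rw [hexp]
    norm_num
  have hsum : ∑ q ∈ B, (gibbsK F ℰp γ K).real {U | a ≤ GaugeGroup.dist1 (GaugeField.plaqHol U q)} ≤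
      B.card * (C₁ * Real.sqrt βK ^ 9 * Real.exp (-(βK * a ^ 2 / 4))) := by
    have h := Finset.sum_le_sum fun q (_ : q ∈ B) => hterm q
    rwa [Finset.sum_const, nsmul_eq_mul] at h
  -- (i) the box count, (ii) `(√β_K)^9 ≤ β_K^5 = L^{5j} β_i^5`, (iii) the exponent `β_K a²/4 = (9/1600) P²/L^{3j}`
  have hBcard : (B.card : ℝ) ≤ 243 * (7 * (F.L : ℝ) + 2) ^ 3 * ((F.L : ℝ) ^ j) ^ 3 := card_box_le F (xs 0) j
  have hsqrt : Real.sqrt βK ^ 9 ≤ ((F.L : ℝ) ^ j) ^ 5 * βi ^ 5 := by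
    have hs1 : 1 ≤ Real.sqrt βK := by rw [← Real.sqrt_one]; exact Real.sqrt_le_sqrt hβK1
    have h9 : Real.sqrt βK ^ 9 ≤ Real.sqrt βK ^ 10 := pow_le_pow_right₀ hs1 (by norm_num)
    have h10 : Real.sqrt βK ^ 10 = βK ^ 5 := by
      rw [show (10 : ℕ) = 2 * 5 from rfl, pow_mul, Real.sq_sqrt (zero_le_one.trans hβK1)]
    refine h9.trans (le_of_eq ?_)
    rw [h10, hβKeq, mul_pow]
  have hexp : Real.exp (-(βK * a ^ 2 / 4)) = Real.exp (-(9 / 1600 * P ^ 2 / ((F.L : ℝ) ^ j) ^ 3)) := by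
    congr 2
    rw [ha, hPL, hα₀, hβKeq, ← hβθ]
    field_simp
    ring
  -- assemble
  calc (gibbsK F ℰp γ K).real {U | θ ≤ GaugeGroup.dist1 (GaugeField.plaqHol
          (Averaging.iter (fun i => BlockAveraging.blockAvg (P := F.P K) (j := i) ℰp) j U) p)}
      ≤ (B.card : ℝ) * (C₁ * Real.sqrt βK ^ 9 * Real.exp (-(βK * a ^ 2 / 4))) := hcover.trans hsum
    _ ≤ (243 * (7 * (F.L : ℝ) + 2) ^ 3 * ((F.L : ℝ) ^ j) ^ 3) *
          (C₁ * (((F.L : ℝ) ^ j) ^ 5 * βi ^ 5) * Real.exp (-(βK * a ^ 2 / 4))) := by gcongr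
    _ = 243 * (7 * (F.L : ℝ) + 2) ^ 3 * C₁ * ((F.L : ℝ) ^ j) ^ 8 * βi ^ 5 *
          Real.exp (-(9 / 1600 * P ^ 2 / ((F.L : ℝ) ^ j) ^ 3)) := by rw [hexp]; ring

end Tail

end Summit.QuantumFields.YangMills.Theorems.RevelationMartingaleMeanDeviationLogDepth

end
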